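import Summits.RiemannHypothesis.RiemannHypothesis.Theorems.PfPersistenceF1AnalyticTwinContinuum
import Literature.NumberTheory.LFunctions.WeilGroundStateRealZerosProofs
import Literature.NumberTheory.LFunctions.WeilMellinInversion

/-!
# PF persistence, fake seat 1 — twins are order-incomparable with `μZ` (FAKES §1.13, LEMMA F1-Y.2 (i))

Unit `pub-rhpf-fake-1` of the `pub-rhpf` cell (mechanism / rigidity campaign; **no RH claims**).

LEMMA F1-Y.2 (i) of FAKES §1.13, typed and PROVED: an analytic twin `μ ∈ AnalyticBLExt U μZ` below a
depth `U > 1` that is a SUPER-measure of `μZ` (`μZ ≤ μ`) or — when `μZ` is itself a twin, e.g. a spectral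
measure — a SUB-measure of `μZ` (`μ ≤ μZ`) EQUALS `μZ`.  Informally: no twin, analytic or honest, is
obtained from `μZ` by only adding mass (`μZ + η`) or only deleting mass (thinning the zeros); every twin
`≠ μZ` must delete somewhere AND add somewhere (the Jordan parts of `μ − μZ` are both nonzero).

Mechanism (elementary): for each `t₀` the tree supplies a Weil test `h` supported in `[-a, a]`,
`a = log U / 4`, with `ĥ(1/2 + it₀) ≠ 0` (`exists_isWeilTest_weilMellin_ne_zero`); the twin condition says
`F = ‖ĥ(1/2 + i·)‖² ≥ 0` has equal integrals, comparability localises this to every measurable set, and on a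
bounded window the finite difference measure integrates `F` to `0`, so it vanishes on the open set
`{F ≠ 0} ∋ t₀`; a countable subcover (Lindelöf) finishes.  Nothing about `ζ` is asserted.
-/

set_option linter.dupNamespace false

noncomputable section

open MeasureTheory Set Complex Filter Topology
open scoped ENNReal

namespace Summit.RiemannHypothesis.RiemannHypothesis.Theorems.PfPersistence.Fake1.AnalyticTwin

open Summit.RiemannHypothesis.RiemannHypothesis.Theorems.PfPersistenceBarrier
open Summit.RiemannHypothesis.RiemannHypothesis.Theorems.PfPersistence.Fake1
open Summit.RiemannHypothesis.RiemannHypothesis.Theorems.PfPersistence.Fake1.BLExt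
open Literature.NumberTheory.LFunctions

/-! ## Comparable measures with one equal integral agree where the integrand is nonzero (PROVED) -/

/-- Set integrals of a nonnegative integrable function against comparable measures with equal total
integral agree on every measurable set. [folklore] -/
theorem setIntegral_eq_of_le_of_integral_eq {μ ν : Measure ℝ} (hle : ν ≤ μ) {F : ℝ → ℝ}
    (hF0 : ∀ t, 0 ≤ F t) (hFμ : Integrable F μ) (heq : ∫ t, F t ∂μ = ∫ t, F t ∂ν)
    {S : Set ℝ} (hS : MeasurableSet S) : ∫ t in S, F t ∂μ = ∫ t in S, F t ∂ν := by
  have hFν : Integrable F ν := hFμ.mono_measure hle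
  have h1 : ∫ t in S, F t ∂ν ≤ ∫ t in S, F t ∂μ :=
    integral_mono_measure (Measure.restrict_mono subset_rfl hle)
      (Eventually.of_forall fun t => hF0 t) hFμ.integrableOn
  have h2 : ∫ t in Sᶜ, F t ∂ν ≤ ∫ t in Sᶜ, F t ∂μ :=
    integral_mono_measure (Measure.restrict_mono subset_rfl hle)
      (Eventually.of_forall fun t => hF0 t) hFμ.integrableOn
  have hμs := integral_add_compl hS hFμ
  have hνs := integral_add_compl hS hFν
  linarith

/-- LOCAL AGREEMENT: if `ν ≤ μ`, `μ` is finite on the window `Icc (-T) T`, and a continuous `F ≥ 0`,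
integrable for `μ`, has the same integral against `μ` and `ν`, then `μ` and `ν` agree on
`{F ≠ 0} ∩ Icc (-T) T`. [folklore] -/
theorem restrict_eq_of_le_of_integral_eq {μ ν : Measure ℝ} (hle : ν ≤ μ) {F : ℝ → ℝ}
    (hF : Continuous F) (hF0 : ∀ t, 0 ≤ F t) (hFμ : Integrable F μ)
    (heq : ∫ t, F t ∂μ = ∫ t, F t ∂ν) {T : ℝ} (hT : μ (Icc (-T) T) ≠ ⊤) :
    μ.restrict ({t | F t ≠ 0} ∩ Icc (-T) T) = ν.restrict ({t | F t ≠ 0} ∩ Icc (-T) T) := by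
  have hW : MeasurableSet (Icc (-T) T) := measurableSet_Icc
  have hAm : MeasurableSet {t | F t ≠ 0} := (isOpen_ne_fun hF continuous_const).measurableSet
  have hleW : ν.restrict (Icc (-T) T) ≤ μ.restrict (Icc (-T) T) := Measure.restrict_mono subset_rfl hle
  haveI : IsFiniteMeasure (ν.restrict (Icc (-T) T)) :=
    ⟨by rw [Measure.restrict_apply_univ]
        exact lt_of_le_of_lt (Measure.le_iff'.1 hle _) (lt_top_iff_ne_top.2 hT)⟩
  obtain ⟨ρ, hρ, hρle⟩ : ∃ ρ : Measure ℝ, ρ + ν.restrict (Icc (-T) T) = μ.restrict (Icc (-T) T) ∧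
      ρ ≤ μ.restrict (Icc (-T) T) :=
    ⟨_, Measure.sub_add_cancel_of_le hleW, Measure.sub_le⟩
  have hFμW : Integrable F (μ.restrict (Icc (-T) T)) := hFμ.integrableOn
  have hFρ : Integrable F ρ := hFμW.mono_measure hρle
  have hFνW : Integrable F (ν.restrict (Icc (-T) T)) := hFμW.mono_measure hleW
  have hint : ∫ t, F t ∂ρ = 0 := by
    have h1 : ∫ t in Icc (-T) T, F t ∂μ = ∫ t in Icc (-T) T, F t ∂ν :=
      setIntegral_eq_of_le_of_integral_eq hle hF0 hFμ heq hW
    have h2 := integral_add_measure hFρ hFνW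
    rw [hρ] at h2
    linarith
  have hae : F =ᵐ[ρ] 0 := (integral_eq_zero_iff_of_nonneg (fun t => hF0 t) hFρ).1 hint
  have hρA : ρ {t | F t ≠ 0} = 0 := by
    have h := hae
    rw [Filter.EventuallyEq, ae_iff] at h
    simpa using h
  ext S hS
  rw [Measure.restrict_apply hS, Measure.restrict_apply hS]
  have e1 : μ (S ∩ ({t | F t ≠ 0} ∩ Icc (-T) T)) = (μ.restrict (Icc (-T) T)) (S ∩ {t | F t ≠ 0}) := by
    rw [Measure.restrict_apply (hS.inter hAm), inter_assoc]
  have e2 : ν (S ∩ ({t | F t ≠ 0} ∩ Icc (-T) T)) = (ν.restrict (Icc (-T) T)) (S ∩ {t | F t ≠ 0}) := by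
    rw [Measure.restrict_apply (hS.inter hAm), inter_assoc]
  rw [e1, e2, ← hρ, Measure.add_apply, measure_mono_null inter_subset_right hρA, zero_add]

/-- GLOBAL AGREEMENT: if `ν ≤ μ`, `μ` is finite on bounded windows, and through every point `t₀` there is
a continuous `F ≥ 0` with `F t₀ ≠ 0`, integrable for `μ`, with equal integrals against `μ` and `ν`, then
`μ = ν` (local agreement on the open cover `{F ≠ 0}`, a countable subcover by Lindelöf). [folklore] -/
theorem eq_of_le_of_forall_integral_eq {μ ν : Measure ℝ} (hle : ν ≤ μ)
    (hfin : ∀ T : ℝ, 0 ≤ T → μ (Icc (-T) T) ≠ ⊤)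
    (h : ∀ t₀ : ℝ, ∃ F : ℝ → ℝ, Continuous F ∧ F t₀ ≠ 0 ∧ (∀ t, 0 ≤ F t) ∧ Integrable F μ ∧
      ∫ t, F t ∂μ = ∫ t, F t ∂ν) : μ = ν := by
  choose F hFc hFt hF0 hFi hFeq using h
  have hAopen : ∀ t₀, IsOpen {t | F t₀ t ≠ 0} := fun t₀ => isOpen_ne_fun (hFc t₀) continuous_const
  obtain ⟨Tset, hTc, hTU⟩ := TopologicalSpace.isOpen_iUnion_countable (fun t₀ => {t | F t₀ t ≠ 0}) hAopen
  have hcover : ⋃ t₀ ∈ Tset, {t | F t₀ t ≠ 0} = univ := by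
    rw [hTU]
    exact eq_univ_of_forall fun x => mem_iUnion.2 ⟨x, hFt x⟩
  haveI : Countable Tset := hTc.to_subtype
  let s : Tset × ℕ → Set ℝ := fun p => {t | F p.1 t ≠ 0} ∩ Icc (-(p.2 : ℝ)) p.2
  have hs : ⋃ p, s p = univ := by
    refine eq_univ_of_forall fun x => ?_
    have hx : x ∈ ⋃ t₀ ∈ Tset, {t | F t₀ t ≠ 0} := by rw [hcover]; trivial
    obtain ⟨t₀, ht₀, hxA⟩ := mem_iUnion₂.1 hx
    obtain ⟨n, hn⟩ := exists_nat_ge |x|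
    exact mem_iUnion.2 ⟨(⟨t₀, ht₀⟩, n), hxA, abs_le.1 hn⟩
  exact (Measure.ext_iff_of_iUnion_eq_univ hs).2 fun p =>
    restrict_eq_of_le_of_integral_eq hle (hFc p.1) (hF0 p.1) (hFi p.1) (hFeq p.1) (hfin p.2 p.2.cast_nonneg)

/-! ## Twins are order-incomparable with `μZ` (LEMMA F1-Y.2 (i), PROVED) -/

/-- Through every height `t₀` there is, below any depth `U > 1`, a Weil test `h` supported in
`[-log U/4, log U/4]` whose squared Mellin modulus `‖ĥ(1/2 + i·)‖²` is continuous, nonnegative and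
nonzero at `t₀`. [folklore] -/
theorem exists_test_sq_ne_zero {U : ℝ} (hU : 1 < U) (t₀ : ℝ) :
    ∃ h : ℝ → ℂ, IsWeilTest h ∧ tsupport h ⊆ Icc (-(Real.log U / 4)) (Real.log U / 4) ∧
      Continuous (fun t : ℝ => ‖weilMellin h (1 / 2 + t * I)‖ ^ 2) ∧
      ‖weilMellin h (1 / 2 + t₀ * I)‖ ^ 2 ≠ 0 := by
  have ha : 0 < Real.log U / 4 := by have := Real.log_pos hU; positivity
  obtain ⟨h, hh, hhs, hne⟩ :=
    ConnesVanSuijlekom.exists_isWeilTest_weilMellin_ne_zero ha (1 / 2 + t₀ * I)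
  refine ⟨h, hh, hhs, ?_, pow_ne_zero 2 (norm_ne_zero_iff.2 hne)⟩
  exact ((continuous_weilMellin hh.1.continuous hh.2).comp (by fun_prop)).norm.pow 2

/-- **No twin is a super-measure of `μZ`** (LEMMA F1-Y.2 (i), first half): an analytic twin of `μZ`
below a depth `U > 1` that dominates `μZ` equals `μZ` — twins are never `μZ + η` with `η ≠ 0`.
[folklore] -/
theorem eq_of_mem_analyticBLExt_of_le {U : ℝ} (hU : 1 < U) {μZ μ : Measure ℝ}
    (hμ : μ ∈ AnalyticBLExt U μZ) (hle : μZ ≤ μ) : μ = μZ := by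
  have h2a : 2 * (Real.log U / 4) < Real.log U := by have := Real.log_pos hU; linarith
  refine eq_of_le_of_forall_integral_eq hle (fun T hT => ?_) fun t₀ => ?_
  · obtain ⟨-, C, N, hgr⟩ := hμ.1
    exact (hgr T hT).1
  · obtain ⟨h, hh, hhs, hc, hne⟩ := exists_test_sq_ne_zero hU t₀
    obtain ⟨hint, heq⟩ := hμ.2 h hh _ hhs h2a
    exact ⟨_, hc, hne, fun t => by positivity, hint, heq⟩

/-- **No twin is a sub-measure of `μZ`** (LEMMA F1-Y.2 (i), second half): when `μZ` is itself a twin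
(e.g. a spectral measure, `self_mem_analyticBLExt`), an analytic twin dominated by `μZ` equals `μZ` —
twins are never obtained by thinning `μZ` (deleting zero mass only). [folklore] -/
theorem eq_of_mem_analyticBLExt_of_ge {U : ℝ} (hU : 1 < U) {μZ μ : Measure ℝ}
    (hZ : μZ ∈ AnalyticBLExt U μZ) (hμ : μ ∈ AnalyticBLExt U μZ) (hle : μ ≤ μZ) : μ = μZ := by
  have h2a : 2 * (Real.log U / 4) < Real.log U := by have := Real.log_pos hU; linarith
  symm
  refine eq_of_le_of_forall_integral_eq hle (fun T hT => ?_) fun t₀ => ?_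
  · obtain ⟨-, C, N, hgr⟩ := hZ.1
    exact (hgr T hT).1
  · obtain ⟨h, hh, hhs, hc, hne⟩ := exists_test_sq_ne_zero hU t₀
    obtain ⟨hint, -⟩ := hZ.2 h hh _ hhs h2a
    obtain ⟨-, heq⟩ := hμ.2 h hh _ hhs h2a
    exact ⟨_, hc, hne, fun t => by positivity, hint, heq.symm⟩

/-- **Twins `≠ μZ` are order-incomparable with `μZ`** (LEMMA F1-Y.2 (i)): for a twin `μ ≠ μZ` below a
depth `U > 1` of a self-twin `μZ`, neither `μZ ≤ μ` nor `μ ≤ μZ`. [folklore] -/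
theorem not_le_and_not_ge_of_mem_analyticBLExt {U : ℝ} (hU : 1 < U) {μZ μ : Measure ℝ}
    (hZ : μZ ∈ AnalyticBLExt U μZ) (hμ : μ ∈ AnalyticBLExt U μZ) (hne : μ ≠ μZ) :
    ¬ μZ ≤ μ ∧ ¬ μ ≤ μZ :=
  ⟨fun hle => hne (eq_of_mem_analyticBLExt_of_le hU hμ hle),
    fun hle => hne (eq_of_mem_analyticBLExt_of_ge hU hZ hμ hle)⟩

/-- **Honest version**: a spectral measure of an honest-below-`U` g-prime system (`μ ∈ BLExt U`, `U > 1`)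
that is comparable with a spectral measure `μZ` of `ζ`'s datum equals it — an honest fake's spectral
measure can neither contain `μZ` nor be contained in it. [folklore] -/
theorem eq_of_mem_blExt_of_le_or_ge {U : ℝ} (hU : 1 < U) {μZ μ : Measure ℝ}
    (hZ : IsSpectralMeasure zetaC μZ) (hμ : μ ∈ BLExt U) (hcomp : μZ ≤ μ ∨ μ ≤ μZ) : μ = μZ := by
  have hμ' : μ ∈ AnalyticBLExt U μZ := blExt_subset_analyticBLExt hZ U hμ
  rcases hcomp with hle | hle
  · exact eq_of_mem_analyticBLExt_of_le hU hμ' hle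
  · exact eq_of_mem_analyticBLExt_of_ge hU (self_mem_analyticBLExt hZ U) hμ' hle

/-- **No additive twins**: `μZ + η` is an analytic twin of `μZ` below a depth `U > 1` only for `η = 0`.
[folklore] -/
theorem eq_zero_of_add_mem_analyticBLExt {U : ℝ} (hU : 1 < U) {μZ η : Measure ℝ}
    (h : μZ + η ∈ AnalyticBLExt U μZ) : η = 0 := by
  have hle : μZ ≤ μZ + η := Measure.le_add_right le_rfl
  have heq : μZ + η = μZ := eq_of_mem_analyticBLExt_of_le hU h hle
  have hfin : ∀ T : ℝ, 0 ≤ T → μZ (Icc (-T) T) ≠ ⊤ := by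
    obtain ⟨-, C, N, hgr⟩ := h.1
    intro T hT
    exact ((Measure.le_iff'.1 hle _).trans_lt (lt_top_iff_ne_top.2 (hgr T hT).1)).ne
  have hunion : (⋃ n : ℕ, Icc (-(n : ℝ)) n) = univ := by
    refine eq_univ_of_forall fun x => ?_
    obtain ⟨n, hn⟩ := exists_nat_ge |x|
    exact mem_iUnion.2 ⟨n, abs_le.mp hn⟩
  refine (Measure.ext_iff_of_iUnion_eq_univ hunion).2 fun n => ?_
  ext S hS
  rw [Measure.restrict_apply hS, Measure.restrict_apply hS, Measure.coe_zero, Pi.zero_apply]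
  have hn : (0 : ℝ) ≤ n := n.cast_nonneg
  have hZfin : μZ (S ∩ Icc (-(n : ℝ)) n) ≠ ⊤ :=
    ((measure_mono inter_subset_right).trans_lt (lt_top_iff_ne_top.2 (hfin n hn))).ne
  have h1 := congrArg (fun ν : Measure ℝ => ν (S ∩ Icc (-(n : ℝ)) n)) heq
  simp only [Measure.add_apply] at h1
  -- μZ A + η A = μZ A with μZ A finite forces η A = 0
  have : μZ (S ∩ Icc (-(n : ℝ)) n) + η (S ∩ Icc (-(n : ℝ)) n) = μZ (S ∩ Icc (-(n : ℝ)) n) + 0 := by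
    rw [add_zero]; exact h1
  exact (ENNReal.add_right_inj hZfin).1 this

end Summit.RiemannHypothesis.RiemannHypothesis.Theorems.PfPersistence.Fake1.AnalyticTwin
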